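import Summits.ResolutionOfSingularities.ResolutionOfSingularities.Theorems.MarkedTransferCampaignW21OrderBoundPos
import Summits.ResolutionOfSingularities.ResolutionOfSingularities.Theorems.MarkedTransferCampaignW21MinDegreeTop
import Summits.ResolutionOfSingularities.ResolutionOfSingularities.Theorems.MarkedTransferCampaignW21Reductions
import Literature.AlgebraicGeometry.Hironaka2017.Lib.TopFrontierAPI
import Literature.RingTheory.MvPowerSeries.HasseDerivOrder
import Literature.RingTheory.MvPowerSeries.HasseDerivFrobenius
import Mathlib.RingTheory.MvPowerSeries.Order
import HarnessLib

/-!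
# [OURS · L1 W2.1] The quantitative Lucas bound `LucasBoundPos p` and the slot theorem `OrderBoundInClassPos p` — PROVED
# for every prime `p` (exponent `e > 0`); the Case-(II) bound `OrderBoundCaseII p` for every prime and every `e`

Rung L (rescue) of cell res-hironaka, RESCUE-SEED row L-G2, slot W2.1 (hypothesis mining for the Case-(I) order bound of
the diff-product `H♭`), seat res-L1-s21-pv-1. Vocabulary: `MarkedTransferCampaignW21OrderBoundInClass.lean` (res-L1-type-o3,
v5 p469920) and its ERRATUM COMPANION `MarkedTransferCampaignW21OrderBoundPos.lean` (p469452: the same closed statements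
with the side condition `0 < e` of the manuscript's range «q = p^e, e > 0», p.48 L25–L26; the `e = 0` slice of the v1–v4
statements is refuted in `MarkedTransferCampaignW21OrderBoundInClassRefutation.lean`).

THIS FILE PROVES, for every prime `p`:
* `lucasBoundPos_holds : LucasBoundPos p` — SIZED-ASK-L §S-s21's FIRST LEMMA (corrected): for a standard expression
  `ε = Σ u(a,b,c) x^a x^{pb} x^{qc}` in `K⟦x₁…xₙ⟧` (`char K = p`, `q = p^e`, `e > 0`, row 052 datum at `x_i = X i`) with
  non-empty top block and `Standing` hypotheses, THERE IS a top-block index `j` with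
  `q|γ_j| + (ord ε ∸ q|γ₀|) ≤ ord (u₀⁻¹ · ∂^{(α+pβ)}ε · ∂^{(qγ₀)}ε)`;
* `orderBoundInClassPos_holds : OrderBoundInClassPos p` — THE SLOT'S OURS THEOREM (corrected): `ord ε ≤ ord H♭(ε)` in
  Case (I) on the LUCAS CLASS `LongGammas ∨ ShortTopGamma`; and `orderBoundLongGammasPos_holds`;
* `orderBoundCaseII_holds : OrderBoundCaseII p` (v4 statement, all `e`): `ord ε ≤ ord (x^{α+pβ} ∂^{(α+pβ)} ε)`, which is
  the unconditional inequality `ord ∂^{(X)} f ≥ ord f − |X|`;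
* the pure-logic assemblies `orderBoundOpOnPos_of` / `orderBoundOpInClassPos_of_caseIII` of the by-case operator
  `HFlat.op` from the three case bounds (Case (III) enters as the hypothesis `OrderBoundCaseIIIPos p`, a CANDIDATE).

PROOF (all in `K⟦x⟧ = MvPowerSeries (Fin n) K`, orders via the bridge `adicOrder = MvPowerSeries.order` of
`MarkedTransferCampaignW21MinDegreeTop.lean`). (1) ROW-054 API (tree `Hironaka2017/Lib/TopFrontierAPI.lean` + complements here): for an effective term `t = (a, b, c)` (`u t ≠ 0`) the
lexicographic maximality of the top pair gives `(toLex a, toLex b) ≤ (toLex α, toLex β)`; hence `α ≤ a ∧ β ≤ b`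
(componentwise) forces `a = α ∧ b = β`, i.e. `t` is in the top block, and the top-block exponents are exactly the
`γ_j`. (2) `∂^{(X)} ε = Σ_t u_t · ∂^{(X)}(x^{a+pb+qc})` for `X = α + pβ` (the coefficients `u_t ∈ ρ^ℓ = {f^{p^ℓ}}` pass
through `∂^{(X)}` because every coordinate of `X` is `< p^ℓ`, `Standing.depth`; tree lemma `hasseDeriv_pow_mul`).
(3) LUCAS SELECTION (tree lemma `le_of_hasseDeriv_monomial_ne_zero`, N. J. Fine 1947; needs `0 < e`): a surviving term
has `α ≤ a`, `β ≤ b` digitwise, hence is a top-block term `u_j x^{α+pβ+qγ_j}`, and `∂^{(α+pβ)}` of it is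
`u_j · x^{qγ_j}` up to a constant, of order `≥ q|γ_j| ≥ q·min_j|γ_j|`; so `ord ∂^{(α+pβ)}ε ≥ q·min_j|γ_j|`
(`le_order_finsetSum`). (4) `ord ∂^{(qγ₀)}ε ≥ ord ε − q|γ₀|` (`order_le_order_hasseDeriv_add_degree`). (5) `ord(u₀⁻¹AB) ≥
ord A + ord B`. Everything here is OURS / folklore; nothing is a statement of or about the manuscript under adjudication
(GAP row R05); AI-produced formalisation, expert review is stronger than AI review.

## References
* N. J. Fine, *Binomial coefficients modulo a prime*, Amer. Math. Monthly 54 (1947) 589–592, Thm 2 [Fine1947] — via the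
  tree's `Literature.RingTheory.MvPowerSeries.le_of_hasseDeriv_monomial_ne_zero`.
* N. Bourbaki, *Algèbre commutative* III §4 no. 5 (21) [Bourbaki1989CommAlg] — divided derivatives (`hasseDeriv`).
-/

noncomputable section

set_option linter.dupNamespace false -- mandated namespace of this single-conjunct summit

namespace Summit.ResolutionOfSingularities.ResolutionOfSingularities.Theorems

namespace CampaignW21

open Literature.AlgebraicGeometry.Hironaka2017.S08UnitMonomial
open Literature.AlgebraicGeometry.Hironaka2017.S09LLUED
open Literature.AlgebraicGeometry.Hironaka2017.S09LLUED.TopFrontier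
open Literature.AlgebraicGeometry.Resolution
open Literature.RingTheory.MvPowerSeries
open MvPowerSeries Finsupp

/-! ## 1. Row-054 API complements: componentwise domination of `(α, β)` forces membership in the top block -/

section TopFrontierAPI

variable {R : Type*} [CommRing R] {n : ℕ} {T : Finset (ExpTriple n)} {u : ExpTriple n → R}

/-- For an effective term `(a, b, c)`, `a ≤lex α` (lexicographic maximality of the top pair, tree
`TopFrontier.pairKey_le`). [folklore] -/
theorem toLex_fst_le_alpha {t : ExpTriple n} (ht : t ∈ effSupport T u) : toLex t.1 ≤ toLex (alpha T u) := by
  rcases Prod.Lex.toLex_le_toLex.1 (pairKey_le T u ht) with h | h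
  · exact le_of_lt h
  · exact le_of_eq h.1

/-- For an effective term with `a = α`, `b ≤lex β`. [folklore] -/
theorem toLex_snd_le_beta {t : ExpTriple n} (ht : t ∈ effSupport T u) (h1 : t.1 = alpha T u) :
    toLex t.2.1 ≤ toLex (beta T u) := by
  rcases Prod.Lex.toLex_le_toLex.1 (pairKey_le T u ht) with h | h
  · exfalso
    have h' : toLex t.1 < toLex (alpha T u) := h
    rw [h1] at h'
    exact lt_irrefl _ h'
  · exact h.2

/-- **An effective term whose pair dominates `(α, β)` componentwise IS a top-block term** (componentwise `≤` implies
`≤lex`, and `(α, β)` is the lexicographic maximum). [folklore] -/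
theorem fst_eq_and_snd_eq_of_le {t : ExpTriple n} (ht : t ∈ effSupport T u) (ha : alpha T u ≤ t.1)
    (hb : beta T u ≤ t.2.1) : t.1 = alpha T u ∧ t.2.1 = beta T u := by
  have h1 : t.1 = alpha T u :=
    toLex_inj.1 (le_antisymm (toLex_fst_le_alpha ht) (Finsupp.toLex_monotone ha))
  exact ⟨h1, toLex_inj.1 (le_antisymm (toLex_snd_le_beta ht h1) (Finsupp.toLex_monotone hb))⟩

/-- Every top-block term is `(α, β, γ_j)` for some index `j` (tree `TopFrontier.exists_gamma_eq`). [folklore] -/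
theorem exists_gamma_eq_of_mem_topBlock {t : ExpTriple n} (ht : t ∈ topBlock T u) : ∃ j, gamma T u j = t.2.2 := by
  obtain ⟨j, hj⟩ := exists_gamma_eq (T := T) (u := u)
    (Finset.mem_image_of_mem (fun s : ExpTriple n => toLex s.2.2) ht)
  exact ⟨j, toLex_inj.1 hj⟩

end TopFrontierAPI

/-! ## 2. The unit-monomial terms at `x_i = X i` are monomials of `K⟦x⟧` -/

section Monomials

variable {K : Type} [Field K] {n : ℕ}

/-- A finite product of monomials with coefficient `1` is the monomial of the sum of the exponents. [folklore] -/
theorem prod_monomial_one {ι : Type*} (s : Finset ι) (f : ι → (Fin n →₀ ℕ)) :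
    ∏ i ∈ s, (monomial (f i) (1 : K) : MvPowerSeries (Fin n) K) = monomial (∑ i ∈ s, f i) 1 := by
  classical
  induction s using Finset.induction_on with
  | empty => simp [monomial_zero_one]
  | insert i s hi ih => rw [Finset.prod_insert hi, Finset.sum_insert hi, ih, monomial_mul_monomial, one_mul]

/-- `∏_i X_i^{d_i} = x^d` (`monomial d 1`) in `K⟦x₁…xₙ⟧`. [folklore] -/
theorem prod_X_pow_eq_monomial (d : Fin n →₀ ℕ) :
    (∏ i, (X i : MvPowerSeries (Fin n) K) ^ d i) = monomial d 1 := by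
  rw [Finset.prod_congr rfl fun i _ => X_pow_eq i (d i), prod_monomial_one, Finsupp.univ_sum_single]

/-- The monomial `x^θ` of row 054 (`TopFrontier.mono`) at `x_i = X i` is `monomial θ 1`. [folklore] -/
theorem mono_xs_eq_monomial (θ : Fin n →₀ ℕ) : TopFrontier.mono (xs K n) θ = monomial θ 1 :=
  prod_X_pow_eq_monomial θ

/-- The unit-monomial term `x^a x^{pb} x^{qc}` of the row-052 datum at `x_i = X i` is `monomial (a + p•b + p^e•c) 1`.
[folklore] -/
theorem term_eq_monomial (p e : ℕ) (t : ExpTriple n) :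
    ((∏ i, xs K n i ^ t.1 i) * (∏ i, xs K n i ^ (p * t.2.1 i)) * ∏ i, xs K n i ^ (p ^ e * t.2.2 i)) =
      monomial (t.1 + p • t.2.1 + p ^ e • t.2.2) (1 : K) := by
  have h1 := prod_X_pow_eq_monomial (K := K) t.1
  have h2 := prod_X_pow_eq_monomial (K := K) (p • t.2.1)
  have h3 := prod_X_pow_eq_monomial (K := K) (p ^ e • t.2.2)
  simp only [Finsupp.coe_smul, Pi.smul_apply, smul_eq_mul] at h2 h3
  show (∏ i, (X i : MvPowerSeries (Fin n) K) ^ t.1 i) * (∏ i, (X i : MvPowerSeries (Fin n) K) ^ (p * t.2.1 i)) *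
      (∏ i, (X i : MvPowerSeries (Fin n) K) ^ (p ^ e * t.2.2 i)) = _
  rw [h1, h2, h3, monomial_mul_monomial, monomial_mul_monomial, mul_one, mul_one]

/-- `|θ| ≤ ord (f · a X^θ)`. [folklore] -/
theorem degree_le_order_mul_monomial (f : MvPowerSeries (Fin n) K) (θ : Fin n →₀ ℕ) (a : K) :
    (θ.degree : ℕ∞) ≤ (f * monomial θ a).order := by
  classical
  refine MvPowerSeries.le_order fun d hd => ?_
  rw [coeff_mul_monomial, if_neg]
  intro hle
  have h1 : θ.degree ≤ d.degree := Finsupp.degree_mono hle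
  have h2 : d.degree < θ.degree := by exact_mod_cast hd
  omega

end Monomials

/-! ## 3. Divided derivatives of a standard expression: the `ρ^ℓ`-coefficients pass through -/

section Derivative

variable (p : ℕ) [hp : Fact p.Prime] {K : Type} [Field K] [CharP K p] {n e ℓ : ℕ}

/-- **`∂^{(X)} Σ_t x^a x^{pb} x^{qc} u_t = Σ_t u_t · ∂^{(X)} x^{a+pb+qc}`** when every coordinate of `X` is `< p^ℓ` and the
`u_t` are `p^ℓ`-th powers (`ρ^ℓ(K⟦x⟧)`): divided derivatives of coordinatewise order `< p^ℓ` are linear over `p^ℓ`-th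
powers (tree `hasseDeriv_pow_mul`). [folklore] -/
theorem hasseDeriv_sum_terms (T : Finset (ExpTriple n)) (u : ExpTriple n → MvPowerSeries (Fin n) K)
    (hu : ∀ t ∈ T, u t ∈ frobPow (MvPowerSeries (Fin n) K) p ℓ) {X : Fin n →₀ ℕ} (hX : ∀ s, X s < p ^ ℓ) :
    hasseDeriv X (∑ t ∈ T,
        ((∏ i, xs K n i ^ t.1 i) * (∏ i, xs K n i ^ (p * t.2.1 i)) * ∏ i, xs K n i ^ (p ^ e * t.2.2 i)) * u t) =
      ∑ t ∈ T, u t * hasseDeriv X (monomial (t.1 + p • t.2.1 + p ^ e • t.2.2) (1 : K)) := by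
  rw [map_sum]
  refine Finset.sum_congr rfl fun t ht => ?_
  obtain ⟨v, hv⟩ := hu t ht
  have hv' : v ^ p ^ ℓ = u t := hv
  rw [term_eq_monomial, mul_comm, ← hv', hasseDeriv_pow_mul p hX]

/-- **`∃ j, q|γ_j| ≤ ord ∂^{(α+pβ)} ε`** for a standard expression with `e > 0` whose top-frontier exponent `α + pβ` has
all coordinates `< p^ℓ`: by LUCAS SELECTION (`le_of_hasseDeriv_monomial_ne_zero`) only top-block terms survive
`∂^{(α+pβ)}`, and the survivor of `u_j x^{α+pβ+qγ_j}` has order `≥ q|γ_j|`. [folklore] -/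
theorem exists_gamma_le_order_hasseDeriv (he : 0 < e) {ε : MvPowerSeries (Fin n) K}
    (S : StandardExpression p (xs K n) e ℓ ε) (h0 : 0 < frontierLength S.support S.u)
    (hX : ∀ s, (alpha S.support S.u + p • beta S.support S.u) s < p ^ ℓ) :
    ∃ j : Fin (frontierLength S.support S.u),
      ((p ^ e * (gamma S.support S.u j).degree : ℕ) : ℕ∞) ≤
        (hasseDeriv (alpha S.support S.u + p • beta S.support S.u) ε).order := by
  classical
  obtain ⟨j, -, hj⟩ := Finset.exists_min_image Finset.univ
    (fun j : Fin (frontierLength S.support S.u) => (gamma S.support S.u j).degree) ⟨⟨0, h0⟩, Finset.mem_univ _⟩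
  refine ⟨j, ?_⟩
  have key := hasseDeriv_sum_terms p (e := e) S.support S.u S.u_mem hX
  rw [← S.sum_eq] at key
  rw [key]
  apply le_order_finsetSum
  intro t ht
  by_cases hu : S.u t = 0
  · rw [hu, zero_mul, order_zero]; exact le_top
  by_cases hD : hasseDeriv (alpha S.support S.u + p • beta S.support S.u)
      (monomial (t.1 + p • t.2.1 + p ^ e • t.2.2) (1 : K)) = 0
  · rw [hD, mul_zero, order_zero]; exact le_top
  have hte : t ∈ effSupport S.support S.u := (mem_effSupport S.support S.u).2 ⟨ht, hu⟩
  have h0T := gamma_mem (T := S.support) (u := S.u) ⟨0, h0⟩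
  obtain ⟨hα, hβ⟩ := le_of_hasseDeriv_monomial_ne_zero he (S.a_lt t ht) (fun i => S.a_lt _ h0T i)
    (S.b_lt t ht) (fun i => S.b_lt _ h0T i) (1 : K) hD
  obtain ⟨h1, h2⟩ := fst_eq_and_snd_eq_of_le hte hα hβ
  obtain ⟨j', hj'⟩ := exists_gamma_eq_of_mem_topBlock ((mem_topBlock S.support S.u).2 ⟨hte, h1, h2⟩)
  rw [h1, h2, hasseDeriv_monomial_add']
  calc ((p ^ e * (gamma S.support S.u j).degree : ℕ) : ℕ∞)
      ≤ ((p ^ e * (gamma S.support S.u j').degree : ℕ) : ℕ∞) := by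
        exact_mod_cast Nat.mul_le_mul_left _ (hj j' (Finset.mem_univ _))
    _ = ((p ^ e • t.2.2).degree : ℕ∞) := by rw [hj', map_nsmul, smul_eq_mul]
    _ ≤ _ := degree_le_order_mul_monomial _ _ _

end Derivative

/-! ## 4. The Lucas bound and the slot theorem (`e > 0`) -/

/-- **[OURS · L1 W2.1] THE QUANTITATIVE LUCAS BOUND in hypothesis form** (`e > 0`): for a standard expression of `ε` in
`K⟦x₁…xₙ⟧` (`char K = p`, row 052 datum at `x_i = X i`, `q = p^e`, `0 < e`) with non-empty top block and `Standing`
hypotheses there is a top-block index `j` with `q|γ_j| + (ord ε ∸ q|γ₀|) ≤ ord (u₀⁻¹ · ∂^{(α+pβ)}ε · ∂^{(qγ₀)}ε)`.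
Replaces the role of the displayed chain of Rem. 9.9 (1) p.51 L5–L6 by the bound the Lucas bookkeeping yields
(DOSSIER §3.1); NOT a statement of the manuscript. [folklore] -/
theorem lucasBound_of_pos (p : ℕ) [Fact p.Prime] (K : Type) [Field K] [CharP K p] (n e ℓ : ℕ) (he : 0 < e)
    (ε : MvPowerSeries (Fin n) K) (S : StandardExpression p (xs K n) e ℓ ε)
    (h0 : 0 < frontierLength S.support S.u) (hS : Standing p e ℓ ε S h0) :
    ∃ j : Fin (frontierLength S.support S.u),
      ((p ^ e * (gamma S.support S.u j).degree : ℕ) : ℕ∞) +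
          (adicOrder ε - ((p ^ e * (gamma S.support S.u ⟨0, h0⟩).degree : ℕ) : ℕ∞)) ≤
        adicOrder (HFlat.caseI (hasseD K n) hS.unit_u0.unit p (p ^ e)
          (alpha S.support S.u) (beta S.support S.u) (gamma S.support S.u ⟨0, h0⟩) ε) := by
  -- depth: every coordinate of `α + pβ` is `< p^ℓ`
  have hX : ∀ s, (alpha S.support S.u + p • beta S.support S.u) s < p ^ ℓ := fun s =>
    lt_of_le_of_lt ((Finsupp.le_degree s _).trans (Finsupp.degree_mono le_self_add)) hS.depth
  obtain ⟨j, hA⟩ := exists_gamma_le_order_hasseDeriv p he S h0 hX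
  refine ⟨j, ?_⟩
  -- the second factor: `ord ε − q|γ₀| ≤ ord ∂^{(qγ₀)} ε`
  have hB : adicOrder ε - ((p ^ e * (gamma S.support S.u ⟨0, h0⟩).degree : ℕ) : ℕ∞) ≤
      (hasseDeriv (p ^ e • gamma S.support S.u ⟨0, h0⟩) ε).order := by
    rw [adicOrder_eq_order]
    have h := Literature.RingTheory.MvPowerSeries.order_le_order_hasseDeriv_add_degree
      (p ^ e • gamma S.support S.u ⟨0, h0⟩) ε
    rw [map_nsmul, smul_eq_mul] at h
    exact tsub_le_iff_right.mpr h
  -- assemble: `ord (u₀⁻¹ · A · B) ≥ ord A + ord B`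
  set u := hS.unit_u0.unit with hu
  show _ ≤ adicOrder ((↑u⁻¹ : MvPowerSeries (Fin n) K) *
      hasseD K n (alpha S.support S.u + p • beta S.support S.u) ε *
      hasseD K n (p ^ e • gamma S.support S.u ⟨0, h0⟩) ε)
  have hunit : adicOrder ((↑u⁻¹ : MvPowerSeries (Fin n) K)) = 0 := adicOrder_of_isUnit (Units.isUnit _)
  have hprod := adicOrder_add_adicOrder_le_mul (↑u⁻¹ : MvPowerSeries (Fin n) K)
    (hasseD K n (alpha S.support S.u + p • beta S.support S.u) ε *
      hasseD K n (p ^ e • gamma S.support S.u ⟨0, h0⟩) ε)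
  rw [hunit, zero_add, ← mul_assoc] at hprod
  refine le_trans ?_ hprod
  rw [adicOrder_eq_order (hasseD K n (alpha S.support S.u + p • beta S.support S.u) ε *
      hasseD K n (p ^ e • gamma S.support S.u ⟨0, h0⟩) ε)]
  exact (add_le_add hA hB).trans MvPowerSeries.le_order_mul

/-- **[OURS · L1 W2.1] `LucasBoundPos p` HOLDS for every prime `p`** (the ERRATUM-companion name, p469452; SIZED-ASK-L
§S-s21 FIRST LEMMA, corrected to `e > 0`). NOT a statement of the manuscript. [folklore] -/
theorem lucasBoundPos_holds (p : ℕ) [Fact p.Prime] : LucasBoundPos p :=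
  fun K _ _ n e ℓ he ε S h0 hS => lucasBound_of_pos p K n e ℓ he ε S h0 hS

/-- **[OURS · L1 W2.1] `LucasBoundPos p → OrderBoundInClassPos p`** (res-L1-k21's reduction p465215 verbatim with the
extra binder): pure `ℕ∞` bookkeeping. [folklore] -/
theorem orderBoundInClassPos_of_lucasBoundPos (p : ℕ) [Fact p.Prime] (hL : LucasBoundPos p) :
    OrderBoundInClassPos p := by
  intro K _ _ n e ℓ he ε S h0 hS _hI hC
  obtain ⟨j, hj⟩ := hL K n e ℓ he ε S h0 hS
  rcases hC with hLong | hShort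
  · exact (hLong j).trans (le_self_add.trans hj)
  · obtain ⟨hq0, hmin⟩ := hShort h0
    exact enat_le_of_short hq0 (Nat.mul_le_mul_left _ (hmin j)) hj

/-- **[OURS · L1 W2.1] `LucasBoundPos p → OrderBoundLongGammasPos p`** (k21's p465215 with the extra binder).
[folklore] -/
theorem orderBoundLongGammasPos_of_lucasBoundPos (p : ℕ) [Fact p.Prime] (hL : LucasBoundPos p) :
    OrderBoundLongGammasPos p := by
  intro K _ _ n e ℓ he ε S h0 hS _hI hC
  obtain ⟨j, hj⟩ := hL K n e ℓ he ε S h0 hS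
  exact (hC j).trans (le_self_add.trans hj)

/-- **[OURS · L1 W2.1] THE SLOT THEOREM (corrected): `OrderBoundInClassPos p` HOLDS for every prime `p`** — the Case-(I)
order bound `ord ε ≤ ord H♭(ε)` on the LUCAS CLASS `LongGammas ∨ ShortTopGamma` of standard-expression data in `K⟦x⟧`,
`q = p^e`, `e > 0`. Replaces the role of Rem. 9.9 (1) / Def. 9.12's order clause (p.51 L5–L6, L30–L32) ON THAT CLASS;
NOT a statement of the manuscript; says nothing about the unrestricted claim (GAP row R05). [folklore] -/
theorem orderBoundInClassPos_holds (p : ℕ) [Fact p.Prime] : OrderBoundInClassPos p :=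
  orderBoundInClassPos_of_lucasBoundPos p (lucasBoundPos_holds p)

/-- **[OURS · L1 W2.1] `OrderBoundLongGammasPos p` HOLDS for every prime `p`** (class (A): all top-block exponents
long). NOT a statement of the manuscript. [folklore] -/
theorem orderBoundLongGammasPos_holds (p : ℕ) [Fact p.Prime] : OrderBoundLongGammasPos p :=
  orderBoundLongGammasPos_of_lucasBoundPos p (lucasBoundPos_holds p)

/-! ## 5. Case (II) (all `e`) and the by-case assembly over `HFlat.op` -/

/-- **[OURS · L1 W2.1] `OrderBoundCaseII p` HOLDS for every prime `p` (and every `e`)**: `ord ε ≤ ord (x^{α+pβ} ·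
∂^{(α+pβ)} ε)` in `K⟦x⟧`, because `ord (x^X · f) = |X| + ord f` and `ord ∂^{(X)} ε ≥ ord ε − |X|`. Neither `Standing`
nor the Case-(II) inequality is used. Replaces the role of Rem. 9.10 (1) p.51 L13–L14 read in `K⟦x⟧`; NOT a statement
of the manuscript. [folklore] -/
theorem orderBoundCaseII_holds (p : ℕ) [Fact p.Prime] : OrderBoundCaseII p := by
  intro K _ _ n e ℓ ε S h0 _hS _hII
  show adicOrder ε ≤ adicOrder (TopFrontier.mono (xs K n) (alpha S.support S.u + p • beta S.support S.u) *
      hasseD K n (alpha S.support S.u + p • beta S.support S.u) ε)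
  rw [mono_xs_eq_monomial, adicOrder_eq_order, adicOrder_eq_order]
  show ε.order ≤ (monomial (alpha S.support S.u + p • beta S.support S.u) (1 : K) *
      hasseDeriv (alpha S.support S.u + p • beta S.support S.u) ε).order
  rw [order_monomial_one_mul]
  exact Literature.RingTheory.MvPowerSeries.order_le_order_hasseDeriv_add_degree _ _

/-- **[OURS · L1 W2.1] by-case assembly**: the three case bounds give the bound over `HFlat.op` (Def. 9.12 «in all three
cases») on the class `C`, `e > 0` — pure logic (the case witness `c` selects the formula). [folklore] -/
theorem orderBoundOpOnPos_of (p : ℕ) [Fact p.Prime]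
    (C : ∀ {K : Type} [Field K] {n ℓ : ℕ} (p e : ℕ) (ε : MvPowerSeries (Fin n) K),
      StandardExpression p (xs K n) e ℓ ε → Prop)
    (hI : OrderBoundOnPos p C) (hII : OrderBoundCaseII p) (hIII : OrderBoundCaseIIIPos p) :
    OrderBoundOpOnPos p C := by
  intro K _ _ n e ℓ he ε S h0 hS c hC
  cases c with
  | I h => exact hI K n e ℓ he ε S h0 hS h hC
  | II h => exact hII K n e ℓ ε S h0 hS h
  | III h => exact hIII K n e ℓ he ε S h0 hS h

/-- **[OURS · L1 W2.1] `OrderBoundCaseIIIPos p → OrderBoundOpInClassPos p`**: with Cases (I) (this file) and (II) (this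
file) proved, the Def. 9.12-shaped bound on the Lucas class, `e > 0`, is reduced to the Case-(III) CANDIDATE
`OrderBoundCaseIIIPos p` (K2.1's Case-(III) columns are its check of record). NOT a statement of the manuscript.
[folklore] -/
theorem orderBoundOpInClassPos_of_caseIII (p : ℕ) [Fact p.Prime] (hIII : OrderBoundCaseIIIPos p) :
    OrderBoundOpInClassPos p :=
  orderBoundOpOnPos_of p LucasClass (orderBoundInClassPos_holds p) (orderBoundCaseII_holds p) hIII

end CampaignW21

end Summit.ResolutionOfSingularities.ResolutionOfSingularities.Theorems

end
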